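import Mathlib.Analysis.SpecificLimits.Normed
import Literature.Analysis.UnboundedOperators.LinearMildFlowKernelContinuity
import HarnessLib

/-!
# The linear mild flow `w(t) = T(t) h − ∫₀ᵗ K(t − s) B(s) w(s) ds` on a short interval

Analysis/UnboundedOperators support file (theorems only, everything proved, no named facts, no
definitions).  Let `E` be a real Banach space, `T(t)` (`t ≥ 0`) contractions, strongly continuous and
norm continuous on `(0, ∞)`, `K(t)` (`t > 0`) bounded operators with the weakly singular bound
`‖K(t)‖ ≤ C t^{-α}` (`0 ≤ α < 1`), strongly and norm continuous on `(0, ∞)` (the abstract `e^{-tA}` and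
`A^α e^{-tA}` of D. Henry, *Geometric Theory of Semilinear Parabolic Equations*, LNM 840 (1981),
Thm 1.4.3), and `B : [0, τ] → L(E)` a norm-continuous coefficient family with `‖B(s)‖ ≤ β`.  The
**linear mild (Volterra) equation**

  `w(t) = T(t) h − ∫₀ᵗ K(t − s) B(s) w(s) ds`     (`0 ≤ t ≤ τ`)

is the variation-of-constants form of the linear non-autonomous parabolic equation
`w' + A w + A^α B(t) w = 0`, `w(0) = h` (Henry 1981, §7.1; it is also the linearisation
`B(s) = N(y(s), ·) + N(·, y(s))` of the semilinear equation `y' + Ay + N(y, y) = f` along a mild solution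
`y`, Henry 1981 Thm 3.4.4 / Cor. 3.4.6, the sibling `SemilinearMildFlow.lean`).  On an interval so short
(or for a coefficient so small) that `C τ^{1−α} β / (1 − α) ≤ 1/2` we construct the solution operators
`W(t) ∈ L(E)`, `W(t) h = w_h(t)`, and prove (`exists_linearMildFlow_of_small`):

* the mild equation, continuity of `t ↦ W(t) h`, uniqueness among continuous solutions, `‖W(t)‖ ≤ 2`;
* **continuity of `t ↦ W(t)` in operator norm on `(0, τ]`** (from the norm continuity of `T`, `K`);
* **Lipschitz dependence on the coefficients**: `‖W_B(t) − W_{B'}(t)‖ ≤ 4 (C τ^{1−α}/(1 − α)) sup ‖B − B'‖`.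

Method (soft, no Grönwall inequality): on the Banach space `X = C([0, τ]; E)` the equation reads
`(1 + P_B) w = A h` with the orbit map `A h = T(·) h` (`exists_orbitCLM`), `P_B = Φ ∘ M_B`, `Φ` the
weakly singular Duhamel operator of `K` (`exists_duhamelCLM`, `‖Φ‖ ≤ C τ^{1−α}/(1 − α)`) and `M_B` the
multiplication by `B` (`exists_mulCLM`); `‖P_B‖ ≤ 1/2`, so `R_B = Σₙ (−P_B)ⁿ` inverts `1 + P_B` with
`‖R_B‖ ≤ 2` (`exists_inverse_one_add_of_norm_le`), `W(t) = ev_t ∘ R_B ∘ A`, uniqueness is the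
injectivity of `1 + P_B`, and the Lipschitz dependence is the resolvent identity
`R_B − R_{B'} = R_B (P_{B'} − P_B) R_{B'}` (`inverse_sub_inverse_eq`).  Norm continuity in `t`
(`continuousOn_Ioc_of_eq_duhamel`) is the uniform-in-`g` modulus of the Duhamel integral of the sibling
`LinearMildFlowKernelContinuity.lean` applied to `g_h = B(·) w_h(·)`, `‖g_h‖ ≤ 2β‖h‖`.  The general case
(any `τ`, `β`) follows by the exponential weight `e^{-γt}` in `LinearMildFlow.lean`.

## References

* D. Henry, *Geometric Theory of Semilinear Parabolic Equations*, LNM 840, Springer (1981), Thm 1.4.3,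
  Lemma 3.3.2, Thm 3.3.3, Thm 3.4.1, Thm 3.4.4, §7.1 (Lemma 7.1.1, Thm 7.1.3). [Henry1981]
* A. Pazy, *Semigroups of Linear Operators and Applications to Partial Differential Equations*,
  Springer (1983), §5.6, §6.3 Thm 6.3.1. [Pazy1983]
-/

noncomputable section

open MeasureTheory Set Filter intervalIntegral
open _root_.Topology

namespace Literature.Analysis.UnboundedOperators

/-! ### Inverting `1 + P` for a small bounded operator `P` -/

section Resolvent

variable {X : Type*} [NormedAddCommGroup X] [NormedSpace ℝ X]

/-- **The resolvent identity** for one-sided inverses: if `R (1 + P) = 1` and `(1 + P') R' = 1` then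
`R − R' = R (P' − P) R'`. [folklore] -/
theorem inverse_sub_inverse_eq {P P' R R' : X →L[ℝ] X} (hR : R * (1 + P) = 1)
    (hR' : (1 + P') * R' = 1) : R - R' = R * (P' - P) * R' := by
  have e : P' - P = (1 + P') - (1 + P) := by abel
  rw [e, mul_sub, sub_mul, mul_assoc R (1 + P') R', hR', hR, mul_one, one_mul]

/-- A left inverse `R` of `1 + P` recovers `z` from `z + P z`: if `z + P z = y` then `z = R y`
(uniqueness of solutions of `(1 + P) z = y`). [folklore] -/
theorem eq_apply_of_add_apply_eq {P R : X →L[ℝ] X} (hR : R * (1 + P) = 1) {z y : X}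
    (h : z + P z = y) : z = R y := by
  have h1 : (R * (1 + P)) z = z := by rw [hR, one_apply_eq_self]
  rw [mul_apply_eq_comp, add_apply, one_apply_eq_self, h] at h1
  exact h1.symm

/-- A right inverse `R` of `1 + P` produces solutions: `R y + P (R y) = y`. [folklore] -/
theorem apply_add_apply_eq {P R : X →L[ℝ] X} (hR : (1 + P) * R = 1) (y : X) :
    R y + P (R y) = y := by
  have h1 : ((1 + P) * R) y = y := by rw [hR, one_apply_eq_self]
  rwa [mul_apply_eq_comp, add_apply, one_apply_eq_self] at h1

/-- **Neumann series**: on a Banach space, a bounded operator `P` with `‖P‖ ≤ 1/2` has `1 + P`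
invertible, with inverse `R = Σₙ (−P)ⁿ` of norm `‖R‖ ≤ (1 − ‖P‖)⁻¹ ≤ 2` (Mathlib's
`geom_series_mul_neg`, `mul_neg_geom_series`, `tsum_geometric_le_of_norm_lt_one`). [folklore] -/
theorem exists_inverse_one_add_of_norm_le [CompleteSpace X] (P : X →L[ℝ] X) (hP : ‖P‖ ≤ 1 / 2) :
    ∃ R : X →L[ℝ] X, R * (1 + P) = 1 ∧ (1 + P) * R = 1 ∧ ‖R‖ ≤ 2 := by
  have h1 : ‖-P‖ < 1 := by rw [norm_neg]; linarith
  refine ⟨∑' n : ℕ, (-P) ^ n, ?_, ?_, ?_⟩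
  · have h := geom_series_mul_neg (-P) h1
    rwa [sub_neg_eq_add] at h
  · have h := mul_neg_geom_series (-P) h1
    rwa [sub_neg_eq_add] at h
  · have h2 : ‖(1 : X →L[ℝ] X)‖ ≤ 1 := by
      rw [ContinuousLinearMap.one_def]
      exact ContinuousLinearMap.norm_id_le
    have h3 : (1 - ‖-P‖)⁻¹ ≤ 2 := by
      rw [norm_neg]
      calc (1 - ‖P‖)⁻¹ ≤ (1 / 2)⁻¹ := inv_anti₀ one_half_pos (by linarith)
        _ = 2 := by norm_num
    calc ‖∑' n : ℕ, (-P) ^ n‖ ≤ ‖(1 : X →L[ℝ] X)‖ - 1 + (1 - ‖-P‖)⁻¹ :=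
          tsum_geometric_le_of_norm_lt_one (-P) h1
      _ ≤ 1 - 1 + 2 := add_le_add (sub_le_sub_right h2 1) h3
      _ = 2 := by norm_num

end Resolvent

variable {E : Type*} [NormedAddCommGroup E] [NormedSpace ℝ E]

/-! ### The multiplication operator `(M b z)(t) = b(t) z(t)` on `C(S; E)` -/

/-- **Multiplication by a continuous operator-valued function** as a bounded bilinear map
`M : C(S; L(E)) × C(S; E) → C(S; E)`, `(M b z)(t) = b(t) z(t)`, `‖M b z‖ ≤ ‖b‖ ‖z‖` (`S` compact, sup
norms): the Nemytskii operator of the evaluation pairing `L(E) × E → E`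
(`exists_nemytskiiBilinearCLM` with `N = id`). [folklore] -/
theorem exists_mulCLM (S : Type*) [TopologicalSpace S] [CompactSpace S] :
    ∃ M : C(S, E →L[ℝ] E) →L[ℝ] C(S, E) →L[ℝ] C(S, E),
      (∀ (b : C(S, E →L[ℝ] E)) (z : C(S, E)) (t : S), M b z t = b t (z t)) ∧
      ∀ (b : C(S, E →L[ℝ] E)) (z : C(S, E)), ‖M b z‖ ≤ ‖b‖ * ‖z‖ := by
  obtain ⟨M, hM, hMn⟩ :=
    exists_nemytskiiBilinearCLM (K := S) (ContinuousLinearMap.id ℝ (E →L[ℝ] E))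
  refine ⟨M, fun b z t => by rw [hM, ContinuousLinearMap.id_apply], fun b z => (hMn b z).trans ?_⟩
  calc ‖ContinuousLinearMap.id ℝ (E →L[ℝ] E)‖ * ‖b‖ * ‖z‖ ≤ 1 * ‖b‖ * ‖z‖ :=
        mul_le_mul_of_nonneg_right (mul_le_mul_of_nonneg_right ContinuousLinearMap.norm_id_le
          (norm_nonneg b)) (norm_nonneg z)
    _ = ‖b‖ * ‖z‖ := by rw [one_mul]

/-! ### Norm continuity in time from the Duhamel representation -/

/-- **Operator-norm continuity in time from a Duhamel representation.**  Let `T` and `K` be norm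
continuous on `(0, ∞)`, `‖K(t)‖ ≤ C t^{-α}` (`0 ≤ α < 1`), and let `W : ℝ → L(E)` satisfy
`W(t) h = T(t) h − ∫₀ᵗ K(t − s) g_h(s) ds` on `[0, τ]` with continuous `g_h`, `‖g_h(s)‖ ≤ M₀ ‖h‖`.  Then
`t ↦ W(t)` is continuous on `(0, τ]` in operator norm: for `‖h‖ ≤ 1`,
`‖W(t) h − W(t₀) h‖ ≤ ‖T(t) − T(t₀)‖ + ‖D g_h (t) − D g_h (t₀)‖`, and the second term is small uniformly
in `h` by `exists_forall_norm_integral_duhamel_sub_le` (Henry 1981, §7.1: the evolution operators are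
continuous in `L(E)` for `t > s`). [folklore] -/
theorem continuousOn_Ioc_of_eq_duhamel {α C τ M₀ : ℝ} {T K W : ℝ → E →L[ℝ] E} {g : E → ℝ → E}
    (hTn : ContinuousOn T (Ioi 0)) (hα₀ : 0 ≤ α) (hα : α < 1) (hC : 0 ≤ C)
    (hK : ∀ t, 0 < t → ‖K t‖ ≤ C * t ^ (-α)) (hKn : ContinuousOn K (Ioi 0)) (hM₀ : 0 ≤ M₀)
    (hg : ∀ h, Continuous (g h)) (hgb : ∀ h s, ‖g h s‖ ≤ M₀ * ‖h‖)
    (hW : ∀ h, ∀ t ∈ Icc 0 τ, W t h = T t h - ∫ s in (0 : ℝ)..t, K (t - s) (g h s)) :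
    ContinuousOn W (Ioc 0 τ) := by
  intro t₀ ht₀
  rw [Metric.continuousWithinAt_iff]
  intro ε hε
  have hε4 : 0 < ε / 4 := by positivity
  obtain ⟨δT, hδT, hT⟩ := Metric.continuousWithinAt_iff.1 (hTn t₀ ht₀.1) (ε / 4) hε4
  obtain ⟨δD, hδD, hD⟩ := exists_forall_norm_integral_duhamel_sub_le (E := E) hα₀ hα hC hK hKn
    ht₀.1.le (ε := ε / (4 * (M₀ + 1))) (by positivity)
  refine ⟨min δT δD, lt_min hδT hδD, fun t ht htd => ?_⟩
  have htT : dist t t₀ < δT := htd.trans_le (min_le_left _ _)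
  have htD : |t - t₀| < δD := by
    rw [← Real.dist_eq]
    exact htd.trans_le (min_le_right _ _)
  have hTt : ‖T t - T t₀‖ ≤ ε / 4 := by
    have h := hT ht.1 htT
    rw [dist_eq_norm] at h
    exact h.le
  rw [dist_eq_norm]
  have hle : ‖W t - W t₀‖ ≤ ε / 2 := by
    refine ContinuousLinearMap.opNorm_le_bound _ (by positivity) fun h => ?_
    rw [sub_apply, hW h t (Ioc_subset_Icc_self ht), hW h t₀ (Ioc_subset_Icc_self ht₀)]
    have h1 : ‖T t h - T t₀ h‖ ≤ ε / 4 * ‖h‖ := by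
      rw [← sub_apply]
      exact (T t - T t₀).le_of_opNorm_le hTt h
    have h2 : ‖(∫ s in (0 : ℝ)..t, K (t - s) (g h s)) - ∫ s in (0 : ℝ)..t₀, K (t₀ - s) (g h s)‖ ≤
        ε / (4 * (M₀ + 1)) * (M₀ * ‖h‖) :=
      hD t ht.1.le htD (g h) (M₀ * ‖h‖) (hg h) (hgb h)
    have h3 : ε / (4 * (M₀ + 1)) * (M₀ * ‖h‖) ≤ ε / 4 * ‖h‖ := by
      rw [div_mul_eq_mul_div, div_le_iff₀ (by positivity : (0 : ℝ) < 4 * (M₀ + 1))]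
      have h0 : 0 ≤ ε * ‖h‖ := mul_nonneg hε.le (norm_nonneg h)
      nlinarith [h0, hM₀]
    calc ‖T t h - (∫ s in (0 : ℝ)..t, K (t - s) (g h s)) -
          (T t₀ h - ∫ s in (0 : ℝ)..t₀, K (t₀ - s) (g h s))‖
        = ‖(T t h - T t₀ h) - ((∫ s in (0 : ℝ)..t, K (t - s) (g h s)) -
            ∫ s in (0 : ℝ)..t₀, K (t₀ - s) (g h s))‖ := by
          congr 1
          abel
      _ ≤ ‖T t h - T t₀ h‖ + ‖(∫ s in (0 : ℝ)..t, K (t - s) (g h s)) -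
            ∫ s in (0 : ℝ)..t₀, K (t₀ - s) (g h s)‖ := norm_sub_le _ _
      _ ≤ ε / 4 * ‖h‖ + ε / 4 * ‖h‖ := add_le_add h1 (h2.trans h3)
      _ = ε / 2 * ‖h‖ := by ring
  exact hle.trans_lt (half_lt_self hε)

/-! ### The solution operators on a short interval -/

/-- **The linear mild flow on a short interval** (Henry 1981, §7.1 with Thm 3.3.3 / Thm 3.4.1; Pazy
1983, §5.6, Thm 6.3.1).  Let `E` be a real Banach space, `T(t)` strongly continuous contractions, norm
continuous on `(0, ∞)`, `K(t)` strongly and norm continuous on `(0, ∞)` with `‖K(t)‖ ≤ C t^{-α}`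
(`C ≥ 0`, `0 ≤ α < 1`), `τ > 0`, `β ≥ 0` with `C τ^{1−α} β/(1 − α) ≤ 1/2`.  For every coefficient family
`B`, norm continuous on `[0, τ]` with `‖B(s)‖ ≤ β`, there are `W(t) ∈ L(E)` with:
`W(t) h = T(t) h − ∫₀ᵗ K(t − s) B(s) W(s) h ds` on `[0, τ]`; `t ↦ W(t) h` continuous on `[0, τ]`; every
continuous solution `z` of the equation equals `W(·) h`; `‖W(t)‖ ≤ 2`; `t ↦ W(t)` continuous on
`(0, τ]` in operator norm; and for a second family `B'` (`‖B'‖ ≤ β`, `‖B − B'‖ ≤ η`) every continuous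
family of solution operators `W'` satisfies `‖W(t) − W'(t)‖ ≤ 4 (C τ^{1−α}/(1 − α)) η`.  Proof by the
Neumann series for `1 + Φ ∘ M_B` on `C([0, τ]; E)` (see the module docstring).
[cite: Henry1981, Lemma 7.1.1 and Thm 3.4.1] -/
theorem exists_linearMildFlow_of_small [CompleteSpace E] (T K : ℝ → E →L[ℝ] E)
    (hTnorm : ∀ t, 0 ≤ t → ‖T t‖ ≤ 1) (hTc : ∀ y : E, Continuous fun t : ℝ => T t y)
    (hTn : ContinuousOn T (Ioi 0)) {α C : ℝ} (hα₀ : 0 ≤ α) (hα : α < 1) (hC : 0 ≤ C)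
    (hK : ∀ t, 0 < t → ‖K t‖ ≤ C * t ^ (-α))
    (hKc : ∀ y : E, ContinuousOn (fun t : ℝ => K t y) (Ioi 0)) (hKn : ContinuousOn K (Ioi 0))
    {τ β : ℝ} (hτ : 0 < τ) (hβ : 0 ≤ β) (hsmall : C * τ ^ (1 - α) / (1 - α) * β ≤ 1 / 2)
    (B : ℝ → E →L[ℝ] E) (hBc : ContinuousOn B (Icc 0 τ)) (hBβ : ∀ s ∈ Icc 0 τ, ‖B s‖ ≤ β) :
    ∃ W : ℝ → E →L[ℝ] E,
      (∀ (h : E) (t : Icc (0 : ℝ) τ), W t h = T t h -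
        ∫ s in (0 : ℝ)..(t : ℝ), K ((t : ℝ) - s) (B s (W s h))) ∧
      (∀ h : E, ContinuousOn (fun t : ℝ => W t h) (Icc 0 τ)) ∧
      (∀ (h : E) (z : C(Icc (0 : ℝ) τ, E)), (∀ t : Icc (0 : ℝ) τ, z t = T t h -
        ∫ s in (0 : ℝ)..(t : ℝ), K ((t : ℝ) - s) (B s (z (Set.projIcc 0 τ hτ.le s)))) →
        ∀ t : Icc (0 : ℝ) τ, z t = W t h) ∧
      (∀ t ∈ Icc 0 τ, ‖W t‖ ≤ 2) ∧ ContinuousOn W (Ioc 0 τ) ∧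
      ∀ (B' : ℝ → E →L[ℝ] E) (W' : ℝ → E →L[ℝ] E) (η : ℝ), ContinuousOn B' (Icc 0 τ) →
        (∀ s ∈ Icc 0 τ, ‖B' s‖ ≤ β) → (∀ s ∈ Icc 0 τ, ‖B s - B' s‖ ≤ η) →
        (∀ (h : E) (t : Icc (0 : ℝ) τ), W' t h = T t h -
          ∫ s in (0 : ℝ)..(t : ℝ), K ((t : ℝ) - s) (B' s (W' s h))) →
        (∀ h : E, ContinuousOn (fun t : ℝ => W' t h) (Icc 0 τ)) →
        ∀ t ∈ Icc 0 τ, ‖W t - W' t‖ ≤ 4 * (C * τ ^ (1 - α) / (1 - α)) * η := by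
  have hα1 : 0 < 1 - α := by linarith
  have hq₀0 : 0 ≤ C * τ ^ (1 - α) / (1 - α) :=
    div_nonneg (mul_nonneg hC (Real.rpow_nonneg hτ.le _)) hα1.le
  -- ### the operators of the mild formulation on `C([0, τ]; E)`
  obtain ⟨A, hA, hAn⟩ := exists_orbitCLM T hTnorm hTc τ
  obtain ⟨Φ, hΦ, hΦn⟩ := exists_duhamelCLM hτ hα hC K hK hKc
  obtain ⟨M, hM, hMn⟩ := exists_mulCLM (E := E) (Icc (0 : ℝ) τ)
  -- the clamping `projIcc` is invisible on `[0, t] ⊆ [0, τ]`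
  have hcoe : ∀ {t : ℝ}, t ≤ τ → ∀ s ∈ Icc 0 t,
      ((Set.projIcc 0 τ hτ.le s : Icc (0 : ℝ) τ) : ℝ) = s := fun ht s hs => by
    rw [Set.projIcc_of_mem hτ.le ⟨hs.1, hs.2.trans ht⟩]
  -- `‖Φ ∘ M b‖ ≤ 1/2` for `‖b‖ ≤ β`
  have hPn : ∀ b : C(Icc (0 : ℝ) τ, E →L[ℝ] E), ‖b‖ ≤ β → ‖Φ.comp (M b)‖ ≤ 1 / 2 := by
    intro b hb
    have hMb : ‖M b‖ ≤ β := ContinuousLinearMap.opNorm_le_bound _ hβ fun z =>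
      (hMn b z).trans (mul_le_mul_of_nonneg_right hb (norm_nonneg z))
    calc ‖Φ.comp (M b)‖ ≤ ‖Φ‖ * ‖M b‖ := Φ.opNorm_comp_le _
      _ ≤ C * τ ^ (1 - α) / (1 - α) * β := mul_le_mul hΦn hMb (M b).opNorm_nonneg hq₀0
      _ ≤ 1 / 2 := hsmall
  -- representation: a continuous solution `z` for the coefficients `B₁` is `R₁ (A h)`
  have hrep : ∀ (B₁ : ℝ → E →L[ℝ] E) (b₁ : C(Icc (0 : ℝ) τ, E →L[ℝ] E)), (∀ t, b₁ t = B₁ t) →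
      ∀ R₁ : C(Icc (0 : ℝ) τ, E) →L[ℝ] C(Icc (0 : ℝ) τ, E), R₁ * (1 + Φ.comp (M b₁)) = 1 →
      ∀ (h : E) (z : C(Icc (0 : ℝ) τ, E)), (∀ t : Icc (0 : ℝ) τ, z t = T t h -
        ∫ s in (0 : ℝ)..(t : ℝ), K ((t : ℝ) - s) (B₁ s (z (Set.projIcc 0 τ hτ.le s)))) →
      z = R₁ (A h) := by
    intro B₁ b₁ hb₁ R₁ hR₁ h z hz
    refine eq_apply_of_add_apply_eq hR₁ ?_
    ext t
    have hint : ∫ s in (0 : ℝ)..(t : ℝ), K ((t : ℝ) - s) (M b₁ z (Set.projIcc 0 τ hτ.le s)) =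
        ∫ s in (0 : ℝ)..(t : ℝ), K ((t : ℝ) - s) (B₁ s (z (Set.projIcc 0 τ hτ.le s))) := by
      refine intervalIntegral.integral_congr fun s hs => ?_
      rw [uIcc_of_le t.2.1] at hs
      show K ((t : ℝ) - s) (M b₁ z (Set.projIcc 0 τ hτ.le s)) =
        K ((t : ℝ) - s) (B₁ s (z (Set.projIcc 0 τ hτ.le s)))
      rw [hM, hb₁, hcoe t.2.2 s hs]
    rw [ContinuousMap.add_apply, ContinuousLinearMap.comp_apply, hΦ, hA, hint, hz t]
    abel
  -- ### the data for `B`: restriction `b`, the inverse `R` of `1 + Φ ∘ M b`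
  set b : C(Icc (0 : ℝ) τ, E →L[ℝ] E) :=
    ⟨(Icc (0 : ℝ) τ).restrict B, continuousOn_iff_continuous_restrict.1 hBc⟩ with hbdef
  have hb : ∀ t, b t = B t := fun t => rfl
  have hbβ : ‖b‖ ≤ β := (ContinuousMap.norm_le _ hβ).2 fun t => hBβ t t.2
  obtain ⟨R, hR1, hR2, hRn⟩ := exists_inverse_one_add_of_norm_le (Φ.comp (M b)) (hPn b hbβ)
  have hRA : ∀ h : E, ‖R (A h)‖ ≤ 2 * ‖h‖ := fun h =>
    (R.le_opNorm _).trans (mul_le_mul hRn (hAn h) (norm_nonneg _) zero_le_two)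
  -- ### the solution operators `W t = ev_t ∘ R ∘ A`
  set W : ℝ → E →L[ℝ] E := fun t =>
    (ContinuousMap.evalCLM ℝ (Set.projIcc 0 τ hτ.le t)).comp (R.comp A) with hWdef
  have hWap : ∀ (t : ℝ) (h : E), W t h = R (A h) (Set.projIcc 0 τ hτ.le t) := fun t h => rfl
  -- the equation with the clamped (globally continuous) integrand `M b (R (A h)) ∘ projIcc`
  have hWeq : ∀ h : E, ∀ t ∈ Icc (0 : ℝ) τ, W t h = T t h -
      ∫ s in (0 : ℝ)..t, K (t - s) (M b (R (A h)) (Set.projIcc 0 τ hτ.le s)) := by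
    intro h t ht
    have hfix : R (A h) = A h - (Φ.comp (M b)) (R (A h)) :=
      eq_sub_of_add_eq (apply_add_apply_eq hR2 (A h))
    have hfix' := congrArg (fun f : C(Icc (0 : ℝ) τ, E) => f ⟨t, ht⟩) hfix
    simp only [ContinuousMap.sub_apply, ContinuousLinearMap.comp_apply, hΦ, hA] at hfix'
    rw [hWap, Set.projIcc_of_mem hτ.le ht]
    exact hfix'
  refine ⟨W, fun h t => ?_, fun h => ?_, fun h z hz t => ?_, fun t _ => ?_, ?_, ?_⟩
  · -- the mild equation
    rw [hWeq h t t.2]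
    congr 1
    refine intervalIntegral.integral_congr fun s hs => ?_
    rw [uIcc_of_le t.2.1] at hs
    show K ((t : ℝ) - s) (M b (R (A h)) (Set.projIcc 0 τ hτ.le s)) = K ((t : ℝ) - s) (B s (W s h))
    rw [hM, hb, hWap, hcoe t.2.2 s hs]
  · -- continuity of `t ↦ W t h`
    exact ((R (A h)).continuous.comp continuous_projIcc).continuousOn
  · -- uniqueness among continuous solutions
    rw [hrep B b hb R hR1 h z hz, hWap, Set.projIcc_val hτ.le t]
  · -- the bound `‖W t‖ ≤ 2`
    refine ContinuousLinearMap.opNorm_le_bound _ zero_le_two fun h => ?_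
    rw [hWap]
    exact (ContinuousMap.norm_coe_le_norm _ _).trans (hRA h)
  · -- norm continuity on `(0, τ]`
    refine continuousOn_Ioc_of_eq_duhamel (M₀ := β * 2)
      (g := fun h s => M b (R (A h)) (Set.projIcc 0 τ hτ.le s)) hTn hα₀ hα hC hK hKn
      (by positivity) (fun h => (M b (R (A h))).continuous.comp continuous_projIcc)
      (fun h s => ?_) hWeq
    calc ‖M b (R (A h)) (Set.projIcc 0 τ hτ.le s)‖ ≤ ‖M b (R (A h))‖ :=
          ContinuousMap.norm_coe_le_norm _ _
      _ ≤ ‖b‖ * ‖R (A h)‖ := hMn _ _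
      _ ≤ β * (2 * ‖h‖) := mul_le_mul hbβ (hRA h) (norm_nonneg _) hβ
      _ = β * 2 * ‖h‖ := by ring
  · -- Lipschitz dependence on the coefficients
    intro B' W' η hB'c hB'β hη hW' hW'c t ht
    have hη0 : 0 ≤ η := (norm_nonneg _).trans (hη 0 ⟨le_rfl, hτ.le⟩)
    set b' : C(Icc (0 : ℝ) τ, E →L[ℝ] E) :=
      ⟨(Icc (0 : ℝ) τ).restrict B', continuousOn_iff_continuous_restrict.1 hB'c⟩ with hb'def
    have hb' : ∀ t, b' t = B' t := fun t => rfl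
    have hb'β : ‖b'‖ ≤ β := (ContinuousMap.norm_le _ hβ).2 fun t => hB'β t t.2
    obtain ⟨R', hR'1, hR'2, hR'n⟩ :=
      exists_inverse_one_add_of_norm_le (Φ.comp (M b')) (hPn b' hb'β)
    -- `W'` is represented through `R'`
    have hrep' : ∀ h : E, W' t h = R' (A h) ⟨t, ht⟩ := by
      intro h
      set z : C(Icc (0 : ℝ) τ, E) :=
        ⟨(Icc (0 : ℝ) τ).restrict fun r => W' r h, continuousOn_iff_continuous_restrict.1 (hW'c h)⟩
        with hzdef
      have hz : ∀ r : Icc (0 : ℝ) τ, z r = T r h -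
          ∫ s in (0 : ℝ)..(r : ℝ), K ((r : ℝ) - s) (B' s (z (Set.projIcc 0 τ hτ.le s))) := by
        intro r
        rw [show z r = W' r h from rfl, hW' h r]
        congr 1
        refine intervalIntegral.integral_congr fun s hs => ?_
        rw [uIcc_of_le r.2.1] at hs
        show K ((r : ℝ) - s) (B' s (W' s h)) =
          K ((r : ℝ) - s) (B' s (W' (Set.projIcc 0 τ hτ.le s) h))
        rw [hcoe r.2.2 s hs]
      exact congrArg (fun f : C(Icc (0 : ℝ) τ, E) => f ⟨t, ht⟩) (hrep B' b' hb' R' hR'1 h z hz)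
    -- the resolvent identity
    have hPP : ‖Φ.comp (M b') - Φ.comp (M b)‖ ≤ C * τ ^ (1 - α) / (1 - α) * η := by
      have hbb : ‖b' - b‖ ≤ η := by
        refine (ContinuousMap.norm_le _ hη0).2 fun s => ?_
        rw [ContinuousMap.sub_apply, hb, hb', norm_sub_rev]
        exact hη s s.2
      have hMbb : ‖M (b' - b)‖ ≤ η := ContinuousLinearMap.opNorm_le_bound _ hη0 fun z =>
        (hMn _ z).trans (mul_le_mul_of_nonneg_right hbb (norm_nonneg z))
      rw [← ContinuousLinearMap.comp_sub, ← map_sub]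
      exact (Φ.opNorm_comp_le _).trans (mul_le_mul hΦn hMbb (norm_nonneg _) hq₀0)
    have hRR : ‖R - R'‖ ≤ 4 * (C * τ ^ (1 - α) / (1 - α)) * η := by
      rw [inverse_sub_inverse_eq hR1 hR'2]
      calc ‖R * (Φ.comp (M b') - Φ.comp (M b)) * R'‖
          ≤ ‖R‖ * ‖Φ.comp (M b') - Φ.comp (M b)‖ * ‖R'‖ :=
            (norm_mul_le _ _).trans
              (mul_le_mul_of_nonneg_right (norm_mul_le _ _) R'.opNorm_nonneg)
        _ ≤ 2 * (C * τ ^ (1 - α) / (1 - α) * η) * 2 :=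
            mul_le_mul (mul_le_mul hRn hPP (Φ.comp (M b') - Φ.comp (M b)).opNorm_nonneg
              zero_le_two) hR'n R'.opNorm_nonneg
              (mul_nonneg zero_le_two (mul_nonneg hq₀0 hη0))
        _ = 4 * (C * τ ^ (1 - α) / (1 - α)) * η := by ring
    refine ContinuousLinearMap.opNorm_le_bound _ (by positivity) fun h => ?_
    rw [sub_apply, hWap, Set.projIcc_of_mem hτ.le ht, hrep' h, ← ContinuousMap.sub_apply,
      ← sub_apply]
    calc ‖(R - R') (A h) ⟨t, ht⟩‖ ≤ ‖(R - R') (A h)‖ := ContinuousMap.norm_coe_le_norm _ _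
      _ ≤ ‖R - R'‖ * ‖A h‖ := (R - R').le_opNorm _
      _ ≤ 4 * (C * τ ^ (1 - α) / (1 - α)) * η * ‖h‖ :=
          mul_le_mul hRR (hAn h) (norm_nonneg _) (by positivity)

end Literature.Analysis.UnboundedOperators

end
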